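import Literature.NumberTheory.EllipticCurves.BhargavaHo2022.TwoMarkedPoints

/-!
# Bhargava–Ho 2022: the minimal members of `F₂` form a large subfamily

Topic `Literature/NumberTheory/EllipticCurves`, cluster `BhargavaHo2022`; a small PROVED addition to the vocabulary file
`TwoMarkedPoints.lean` (no new fact asserted).

**Source** (held, `paper:arxiv-2207.03309`): M. Bhargava, W. Ho, *On average sizes of Selmer groups and ranks in families of
elliptic curves having marked points*, arXiv:2207.03309 (2022) [BhargavaHo2022], §1, after Thm. 1.1 (p0002): "we observe that an
elliptic curve `E ∈ F` always has a unique representative in `F` of minimal height, which we then call a minimal element of `F`. …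
In general, for each of our families `F`, a curve is minimal in `F` exactly when, for every prime `p`, it is not the case that
`pⁱ ∣ aᵢ` (and `pⁱ ∣ aᵢ'` and `pⁱ ∣ aᵢ''`) for all `i`." and, after Thm. 1.2: "Note that the sets of all curves and the sets of all
minimal curves in `F₀`, `F₁`, `F₁(2)`, `F₁(3)`, and `F₂` are large."

## Contents
* `CongruenceFamily₂.minimal` — the subfamily of MINIMAL members of `F₂`: at each prime `p` the residue condition modulo `p³`
  «not (`p ∣ a₁` and `p² ∣ a₂` and `p² ∣ a₂'` and `p³ ∣ a₃`)» (the printed condition; `p² ∣ a₂'' = -(a₂ + a₂')` is then automatic);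
  `CongruenceFamily₂.mem_minimal_iff` (PROVED: membership is the printed divisibility condition).
* `Params.curveInt_Δ_of_dvd` (PROVED): if `p ∣ a₁`, `p² ∣ a₂`, `p² ∣ a₂'`, `p³ ∣ a₃` then `Δ(a) = p¹² · Δ(a/p)` for the descaled
  parameters — the discriminant polynomial of `F₂` is weighted homogeneous of degree `12` for the weights `(1, 2, 2, 3)`.
* `CongruenceFamily₂.isLargeAt_minimal`, `CongruenceFamily₂.isLarge_minimal` (PROVED): "the sets of all minimal curves in … `F₂`
  are large" — a member with `p² ∤ Δ(a)` is minimal at `p`.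
Consumers: every statement over large subfamilies of `F₂` (e.g. the crux `SelmerThreeAverageLargeF2` of route
`CountingDoorF2AtThree`, Bhargava–Ho Thm. 1.2 `thm1_2_F2_selmerTwo`) thereby also holds for the family of minimal members, i.e. with
every `ℚ`-isomorphism class of `F₂`-curves counted through its minimal-height representatives ("ordered by minimal height").

References: [BhargavaHo2022] §1 (p0002 L30–L45: minimal elements; after Thm. 1.2: minimal curves form a large family).
-/

namespace Literature.NumberTheory.EllipticCurves.BhargavaHo2022

namespace Params

/-- Descaling the parameters by a prime power pattern `(p, p², p², p³)` scales the discriminant polynomial of `F₂` by `p¹²`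
(weighted homogeneity of `Δ` for the weights `(1, 2, 2, 3)`). [cite: BhargavaHo2022, §1 (the height `max{|aᵢ|^{12/i}, …}` and
the definition of minimal elements, p0002)] -/
theorem curveInt_Δ_smul (p : ℤ) (x : Params) :
    (⟨p * x.a₁, p ^ 2 * x.a₂, p ^ 2 * x.a₂', p ^ 3 * x.a₃⟩ : Params).curveInt.Δ = p ^ 12 * x.curveInt.Δ := by
  simp only [curveInt, WeierstrassCurve.Δ, WeierstrassCurve.b₂, WeierstrassCurve.b₄, WeierstrassCurve.b₆,
    WeierstrassCurve.b₈]
  ring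

/-- If `p ∣ a₁`, `p² ∣ a₂`, `p² ∣ a₂'` and `p³ ∣ a₃` then `p¹² ∣ Δ(a)`. [cite: BhargavaHo2022, §1 (minimal elements, p0002)] -/
theorem pow_twelve_dvd_curveInt_Δ {p : ℤ} {a : Params} (h₁ : p ∣ a.a₁) (h₂ : p ^ 2 ∣ a.a₂) (h₂' : p ^ 2 ∣ a.a₂')
    (h₃ : p ^ 3 ∣ a.a₃) : p ^ 12 ∣ a.curveInt.Δ := by
  obtain ⟨x₁, hx₁⟩ := h₁
  obtain ⟨x₂, hx₂⟩ := h₂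
  obtain ⟨x₂', hx₂'⟩ := h₂'
  obtain ⟨x₃, hx₃⟩ := h₃
  have ha : a = (⟨p * x₁, p ^ 2 * x₂, p ^ 2 * x₂', p ^ 3 * x₃⟩ : Params) := by
    cases a
    simp only [Params.mk.injEq]
    exact ⟨hx₁, hx₂, hx₂', hx₃⟩
  rw [ha, curveInt_Δ_smul p ⟨x₁, x₂, x₂', x₃⟩]
  exact dvd_mul_right _ _

end Params

namespace CongruenceFamily₂

/-- **The subfamily of minimal members of `F₂`**: "a curve is minimal in `F` exactly when, for every prime `p`, it is not the case
that `pⁱ ∣ aᵢ` (and `pⁱ ∣ aᵢ'` and `pⁱ ∣ aᵢ''`) for all `i`" — at each prime `p` the condition, on the residue of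
`(a₁, a₂, a₂', a₃)` modulo `p³`, that not all of `a₁ ≡ 0 (mod p)`, `a₂ ≡ 0 (mod p²)`, `a₂' ≡ 0 (mod p²)`, `a₃ ≡ 0 (mod p³)` hold
(read through the reduction maps `ZMod (p³) → ZMod p`, `ZMod (p³) → ZMod (p²)`; the printed `p² ∣ a₂'' = -(a₂ + a₂')` is implied).
[cite: BhargavaHo2022, §1 (definition of minimal elements of F₂, p0002)] -/
def minimal : CongruenceFamily₂ where
  expt := fun _ ↦ 3
  residues := fun p ↦ {r | ¬ (ZMod.castHom (dvd_pow_self p three_ne_zero) (ZMod p) r.1 = 0 ∧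
      ZMod.castHom (pow_dvd_pow p (by norm_num : 2 ≤ 3)) (ZMod (p ^ 2)) r.2.1 = 0 ∧
      ZMod.castHom (pow_dvd_pow p (by norm_num : 2 ≤ 3)) (ZMod (p ^ 2)) r.2.2.1 = 0 ∧ r.2.2.2 = 0)}

/-- The residue condition of `minimal` at `p`, unfolded on integer parameters: it fails exactly when `p ∣ a₁`, `p² ∣ a₂`, `p² ∣ a₂'`
and `p³ ∣ a₃`. [cite: BhargavaHo2022, §1 (definition of minimal elements of F₂, p0002)] -/
theorem residueOf_mem_minimal_iff (p : ℕ) (a : Params) :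
    minimal.residueOf p a ∈ minimal.residues p ↔
      ¬ ((p : ℤ) ∣ a.a₁ ∧ (p : ℤ) ^ 2 ∣ a.a₂ ∧ (p : ℤ) ^ 2 ∣ a.a₂' ∧ (p : ℤ) ^ 3 ∣ a.a₃) := by
  change ¬ (ZMod.castHom (dvd_pow_self p three_ne_zero) (ZMod p) ((a.a₁ : ℤ) : ZMod (p ^ 3)) = 0 ∧
      ZMod.castHom (pow_dvd_pow p (by norm_num : 2 ≤ 3)) (ZMod (p ^ 2)) ((a.a₂ : ℤ) : ZMod (p ^ 3)) = 0 ∧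
      ZMod.castHom (pow_dvd_pow p (by norm_num : 2 ≤ 3)) (ZMod (p ^ 2)) ((a.a₂' : ℤ) : ZMod (p ^ 3)) = 0 ∧
      ((a.a₃ : ℤ) : ZMod (p ^ 3)) = 0) ↔ _
  simp only [map_intCast, ZMod.intCast_zmod_eq_zero_iff_dvd, Nat.cast_pow]

/-- **Membership in the minimal subfamily** is the printed condition: `Δ(a) ≠ 0` and, for every prime `p`, not all of `p ∣ a₁`,
`p² ∣ a₂`, `p² ∣ a₂'`, `p³ ∣ a₃`. [cite: BhargavaHo2022, §1 (definition of minimal elements of F₂, p0002)] -/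
theorem mem_minimal_iff (a : Params) : minimal.Mem a ↔ a.IsMember ∧
    ∀ p : ℕ, p.Prime → ¬ ((p : ℤ) ∣ a.a₁ ∧ (p : ℤ) ^ 2 ∣ a.a₂ ∧ (p : ℤ) ^ 2 ∣ a.a₂' ∧ (p : ℤ) ^ 3 ∣ a.a₃) := by
  simp only [Mem, residueOf_mem_minimal_iff]

/-- **The minimal subfamily is large at every `p`**: a member with `p² ∤ Δ(a)` is minimal at `p`, because `p ∣ a₁`, `p² ∣ a₂`,
`p² ∣ a₂'`, `p³ ∣ a₃` force `p¹² ∣ Δ(a)`. [cite: BhargavaHo2022, §1 ("the sets of all minimal curves in … F₂ are large")] -/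
theorem isLargeAt_minimal (p : ℕ) : minimal.IsLargeAt p := by
  intro a _ hΔ
  rw [residueOf_mem_minimal_iff]
  rintro ⟨h₁, h₂, h₂', h₃⟩
  exact hΔ ((pow_dvd_pow (p : ℤ) (by norm_num : 2 ≤ 12)).trans (Params.pow_twelve_dvd_curveInt_Δ h₁ h₂ h₂' h₃))

/-- **"The sets of all minimal curves in … `F₂` are large."** [cite: BhargavaHo2022, §1 (after Thm. 1.2)] -/
theorem isLarge_minimal : minimal.IsLarge :=
  ⟨0, fun p _ _ ↦ isLargeAt_minimal p⟩

/-- Every residue set of the minimal subfamily is nonempty (the residue of the member `y² = x³ - x`, parameters `(0, 1, -1, 0)`,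
which is minimal at every `p`). [cite: BhargavaHo2022, §1 (minimal elements of F₂, p0002)] -/
theorem residues_minimal_nonempty (p : ℕ) (hp : p.Prime) : (minimal.residues p).Nonempty := by
  refine ⟨minimal.residueOf p ⟨0, 1, -1, 0⟩, ?_⟩
  rw [residueOf_mem_minimal_iff]
  rintro ⟨-, h₂, -, -⟩
  have h1 : ((p : ℤ) ^ 2).natAbs ∣ (1 : ℤ).natAbs := Int.natAbs_dvd_natAbs.mpr h₂
  simp only [Int.natAbs_pow, Int.natAbs_natCast, Int.natAbs_one, Nat.dvd_one, Nat.pow_eq_one, OfNat.ofNat_ne_zero,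
    or_false] at h1
  exact hp.one_lt.ne' h1

end CongruenceFamily₂

end Literature.NumberTheory.EllipticCurves.BhargavaHo2022
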